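import Summits.KontsevichZagierPeriods.KontsevichZagierPeriods.Theses.FurushoPentagon
import Summits.KontsevichZagierPeriods.KontsevichZagierPeriods.Theorems.ReducedPeriodRing.Negative.RingForms
import Literature.NumberTheory.Transcendental.KZKernelConjectureForms
import Literature.NumberTheory.Transcendental.KZRulesAssociator
import Literature.NumberTheory.Transcendental.MultipleZetaValues

/-!
# `KernelModuloPeriodConjecture` (stmt-KontsevichZagierPeriods-15058), line `Sketch`: formal Hoffman
# spanning is implied by Conjecture 1 and Brown's theorem

Cdisprove unit of the crux `KernelModuloPeriodConjecture` (route `FurushoPentagon`). The line `Sketch`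
feeds its OPEN algebraic leaf A (`stub_associatorHoffmanSpanning`, a statement about ALL associators)
into the landed glue G1 only to obtain FORMAL HOFFMAN SPANNING in `P_ℚ = ℚ ⊗ P`: every class
`1 ⊗ ⟦ζ(s)⟧` lies in the `ℚ`-span of the Hoffman classes `1 ⊗ ⟦ζ(t)⟧`, `t ∈ {2,3}^×` (the consequent
of `stub_formalHoffmanSpan`, the antecedent of `stub_sectorKernelOfFormalSpan`).

PROVED here — the LOGICAL POSITION of that intermediate: `formalHoffmanSpan_of_kernelForm`,
`formalHoffmanSpan_of_summit`: formal Hoffman spanning follows from Conjecture 1 (kernel form, i.e. the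
summit `KontsevichZagierPeriods`) together with Brown's theorem in its real form (the tree's named fact
`hoffmanSpan_eq_mzvSpace`, Brown 2012 Thm 1.1). Mechanism: under the kernel form `evalP : P → ℝ` is
injective (tree `kzKernelConjecture_iff_injective_evalP`), hence so is `evalPQ : P_ℚ → ℝ`
(`evalPQ_injective_of_kernelForm`, via `exists_inv_nat_tmul`: every element of `ℚ ⊗_ℤ P` is
`(1/N) ⊗ p`), and a real Hoffman expansion of `ζ(s)` lifts uniquely. CONTRAST (companion file
`StubAImpliesBrownSpanning.lean`): the leaf A itself IMPLIES Brown's theorem and is NOT implied by the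
summit. So if A (= `𝔤𝔯𝔱₁ = 𝔤^𝔪` in coordinates) stalls, the honest rules-side residual of the line is
formal Hoffman spanning, which is summit-implied modulo a theorem in print — a strictly safer target.

Sources: F. Brown, Ann. of Math. 175 (2012), Thm 1.1; M. Kontsevich, D. Zagier, *Periods* (2001),
§1.2, §4.1.
-/

noncomputable section

namespace Summit.KontsevichZagierPeriods.KernelModuloPeriodConjecture.Negative

open scoped TensorProduct
open Literature.NumberTheory.Transcendental
open Literature.NumberTheory.Transcendental.KZ
open Summit.KontsevichZagierPeriods.KontsevichZagierPeriods.Theses.FurushoPentagon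
open Summit.KontsevichZagierPeriods.KontsevichZagierPeriods.ReducedPeriodRingNegative
  (kzKernelConjecture_iff_injective_evalP withEvalHyp_iff_summit)

/-- **Every element of `P_ℚ = ℚ ⊗_ℤ P` is `(1/N) ⊗ p`** for some positive integer `N` and `p ∈ P`
(common denominators). [folklore] -/
theorem exists_inv_nat_tmul (y : FormalPeriodAlgebra) :
    ∃ (N : ℕ) (p : FormalPeriodRing), 0 < N ∧ y = ((1 : ℚ) / N) ⊗ₜ[ℤ] p := by
  induction y using TensorProduct.induction_on with
  | zero => exact ⟨1, 0, one_pos, by simp⟩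
  | tmul q p =>
    refine ⟨q.den, q.num • p, q.den_pos, ?_⟩
    rw [← TensorProduct.smul_tmul, zsmul_eq_mul, mul_one_div, Rat.num_div_den]
  | add x y hx hy =>
    obtain ⟨N, p, hN, rfl⟩ := hx
    obtain ⟨M, p', hM, rfl⟩ := hy
    refine ⟨N * M, (M : ℤ) • p + (N : ℤ) • p', Nat.mul_pos hN hM, ?_⟩
    rw [TensorProduct.tmul_add, ← TensorProduct.smul_tmul, ← TensorProduct.smul_tmul, zsmul_eq_mul,
      zsmul_eq_mul]
    have hN' : (N : ℚ) ≠ 0 := by exact_mod_cast hN.ne'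
    have hM' : (M : ℚ) ≠ 0 := by exact_mod_cast hM.ne'
    congr 2
    · push_cast; field_simp
    · push_cast; field_simp

/-- **Under the kernel form, `evalPQ : P_ℚ → ℝ` is injective** (from injectivity of `evalP`, tree
`kzKernelConjecture_iff_injective_evalP`, and `exists_inv_nat_tmul`). [folklore] -/
theorem evalPQ_injective_of_kernelForm (hK : ∀ c : FormalRep, eval c = 0 → c ∈ relations) :
    Function.Injective evalPQ := by
  have hinj : Function.Injective evalP := kzKernelConjecture_iff_injective_evalP.mp hK
  rw [injective_iff_map_eq_zero]
  intro y hy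
  obtain ⟨N, p, hN, rfl⟩ := exists_inv_nat_tmul y
  rw [evalPQ_tmul] at hy
  have hN' : ((1 : ℚ) / N : ℚ) ≠ 0 := by
    have : (N : ℚ) ≠ 0 := by exact_mod_cast hN.ne'
    exact one_div_ne_zero this
  have hp : evalP p = 0 := by
    rcases mul_eq_zero.mp hy with h | h
    · exact absurd (by exact_mod_cast h) hN'
    · exact h
  have hp0 : p = 0 := hinj (by rw [hp, map_zero])
  rw [hp0, TensorProduct.tmul_zero]

/-- **Formal Hoffman spanning from the kernel form and Brown's theorem.** If `ker eval = relations`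
and the real Hoffman values span every `𝒵_n` (`hoffmanSpan_eq_mzvSpace`, Brown 2012 Thm 1.1, a named
fact of the tree), then in `P_ℚ` every `1 ⊗ ⟦ζ(s)⟧` (`s` admissible) is a `ℚ`-combination of the
Hoffman classes: the real expansion lifts along the injective `evalPQ`. [cite: Brown2012, Thm 1.1] -/
theorem formalHoffmanSpan_of_kernelForm (hB : hoffmanSpan_eq_mzvSpace)
    (hK : ∀ c : FormalRep, eval c = 0 → c ∈ relations) :
    ∀ s : List ℕ, MZV.IsAdmissible s → toPeriodAlgebra (mzvClass s) ∈
      Submodule.span ℚ (Set.range (fun t : {t : List ℕ // MZV.IsHoffman t} =>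
        toPeriodAlgebra (mzvClass t.1))) := by
  intro s hs
  set V : Submodule ℚ FormalPeriodAlgebra := Submodule.span ℚ (Set.range
    (fun t : {t : List ℕ // MZV.IsHoffman t} => toPeriodAlgebra (mzvClass t.1))) with hV
  have hζ : multipleZeta s ∈ hoffmanSpan (MZV.weight s) := by
    rw [hB]
    exact Submodule.subset_span ⟨s, hs, rfl, rfl⟩
  have hle : hoffmanSpan (MZV.weight s) ≤ V.map (evalPQ.toLinearMap) := by
    refine Submodule.span_le.mpr ?_
    rintro x ⟨t, ht, -, rfl⟩
    refine ⟨toPeriodAlgebra (mzvClass t), Submodule.subset_span ⟨⟨t, ht⟩, rfl⟩, ?_⟩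
    simp [evalP_mzvClass ht.isAdmissible]
  obtain ⟨v, hv, hveq⟩ := hle hζ
  have heq : toPeriodAlgebra (mzvClass s) = v := by
    refine evalPQ_injective_of_kernelForm hK ?_
    change evalPQ (toPeriodAlgebra (mzvClass s)) = evalPQ.toLinearMap v
    rw [hveq, evalPQ_toPeriodAlgebra, evalP_mzvClass hs]
  rw [heq]
  exact hv

/-- **Formal Hoffman spanning from Conjecture 1 and Brown's theorem** (the summit is the kernel form:
tree `withEvalHyp_iff_summit`). [cite: Brown2012, Thm 1.1] -/
theorem formalHoffmanSpan_of_summit (hB : hoffmanSpan_eq_mzvSpace) (h : KontsevichZagierPeriods) :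
    ∀ s : List ℕ, MZV.IsAdmissible s → toPeriodAlgebra (mzvClass s) ∈
      Submodule.span ℚ (Set.range (fun t : {t : List ℕ // MZV.IsHoffman t} =>
        toPeriodAlgebra (mzvClass t.1))) :=
  formalHoffmanSpan_of_kernelForm hB (withEvalHyp_iff_summit.mpr h)

end Summit.KontsevichZagierPeriods.KernelModuloPeriodConjecture.Negative

end
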